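import Summits.BirchSwinnertonDyer.BirchSwinnertonDyer.Theses.KatoDescentPotSupersingular
import Summits.BirchSwinnertonDyer.BirchSwinnertonDyer.Theorems.KatoDescentPotSupersingularReducibleKatoMemberOfFineInputsPotSupersingular
import Literature.NumberTheory.EllipticCurves.NonEisensteinPrimeOfSurjective
import HarnessLib

/-!
# Route `KatoDescentPotSupersingular` (K9): U₀-red `WildUpperReducibleDefect` BY NAME, and the rank-`0` assembly's row text with
# crux M REPLACED, from {modularity, `exists_memberHullZetaFineInputs`, H2X⁺, Lim 3.5, Ferrero–Washington} (+ Cassels / GZK /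
# entire `L`) — NO Imai, NO 27962 (`--supports` crux M = stmt-BirchSwinnertonDyer-19196; seat `bsd-potss-rkm` g31; closes nothing)

Every K9 row is a WILD row `ClassO6 W 3`, hence potentially SUPERSINGULAR at `3`, and there Imai's finiteness `W'(ℚ_{3,∞})[3^∞] < ∞`
(hypothesis `hfin` of H2X⁺, at Kato's member `W'`) is a TREE THEOREM (`TowerTorsionFinite…`, p680430: Serre 1967 §5 Prop. 8
proved by cell `bsd-wall`).  The route-free sibling `…ReducibleKatoMemberOfFineInputsPotSupersingular` (p680784) runs crux M's
whole chain per row with that theorem in place of Imai.  Consequences BY NAME on this route: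

* `wildUpperReducibleDefect_of_fineInputs` — item 19190 `WildUpperReducibleDefect` (U₀-red) from {`exists_isNewformOf`,
  `exists_memberHullZetaFineInputs`, `exists_iwasawaH2Data_fineSelmerDual_embedding_count`, Lim 3.5, Ferrero–Washington,
  `bsdRHS_eq_of_isIsogenous`, GZK, `hasEntireLFunction_rat`} — every binder a NAMED Literature constant, NO Imai, NO 27962, and
  WITHOUT the row's «small class torsion ∧ even `ord₃ #Ш_an`» escape clause (the SHARP `2·ord₃ #tors` count absorbs it);
  `…_of_aliases` — the same over the route's live U₀-red aliases `PublishedInputModularityU0Red`, `PublishedInputsCasselsGZKEntireU0Red`;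
* `missingPPartAt_of_lower_of_fineInputs_of_classO6` — THE ROW TEXT OF `WildRankZeroAssembly` (item 19199) WITH `ReducibleKatoMember`
  REPLACED by the five named facts: `WildLowerHalfRankZero → exists_isNewformOf → Fine → H2X⁺ → Lim → FW → PublishedInputsO6 →
  ∀ W, r_an = 0 → ClassO6 W 3 → (branch A ∨ branch B) → MissingPPartAt W 3` (branch A verbatim as in `wildRankZeroAssembly_proof`;
  branch B = the per-row U₀-red theorem, which needs only `¬ Irr`).

HONEST FRAMING.  Theorems only; conditional on the displayed named facts (Kato's Euler-system theorems Fine / H2X⁺ are cite-level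
and expected to stay so); closes nothing (19190 is closed by its glue over 27962; M = 19196 ranges over potentially ORDINARY rows
too and keeps Imai there); BSD is proved for no curve; nothing is booked.  What the planner may read off: on K9, BOTH uses of
Kato's member package (M in the assembly's branch B, U₀-red) are served by {modularity, Fine, H2X⁺, Lim, FW} with no local-torsion
input — a re-key of M to its potentially-supersingular restriction would drop Imai from the route's trust base.

References: [Kato2004Asterisque] Thm. 12.5 (p. 222), Thm. 14.5 (pp. 235–236), §14.14 (p. 243), Prop. 14.16 (2) (pp. 244–245);
[Serre1967GroupesPDivisibles] §5 Prop. 8; [Imai1975] Theorem (p. 12); [Cassels1965ArithmeticVIII]; [Miller2011LMS] §1 Def. 1.1.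
-/

-- the summit and its single problem are both named `BirchSwinnertonDyer` (registry layout D-0017)
set_option linter.dupNamespace false
set_option autoImplicit false

noncomputable section

open scoped Classical NumberField
open IsDedekindDomain WeierstrassCurve
open Literature.NumberTheory.EllipticCurves Literature.NumberTheory.EllipticCurves.ModularForms
  Literature.NumberTheory.EllipticCurves.Kato2004 Literature.NumberTheory.GaloisRepresentations
  Literature.NumberTheory.EllipticCurves.Rank1Residual Literature.NumberTheory.EllipticCurves.Rank1Residual.Typed
open Summit.BirchSwinnertonDyer.Rank1Residual Summit.BirchSwinnertonDyer.Rank1Residual.Additive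
open Summit.BirchSwinnertonDyer.BirchSwinnertonDyer.Theorems
open Summit.BirchSwinnertonDyer.BirchSwinnertonDyer.Theses.KatoDescentPotSupersingular

namespace Summit.BirchSwinnertonDyer.BirchSwinnertonDyer.Theorems.FineInputsPotSSK9

/-- **Item 19190 `WildUpperReducibleDefect` (K9's U₀-red) BY NAME from {modularity, Fine, H2X⁺, Lim 3.5, FW, Cassels, GZK, entire `L`}
— NO Imai, NO 27962, no small-torsion / parity clause used** (per row: `FineInputsPotSupersingular.missingUpperBoundAt_of_fineInputs_of_classO6`).
Conditional on the displayed named facts. [cite: Kato2004Asterisque, proof of Prop. 14.16 (pp. 244–245), §14.14 (p. 243)]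
[cite: Serre1967GroupesPDivisibles, §5 Prop. 8] [cite: Cassels1965ArithmeticVIII] -/
theorem wildUpperReducibleDefect_of_fineInputs (hmod : exists_isNewformOf)
    (hF : exists_memberHullZetaFineInputs) (hH : exists_iwasawaH2Data_fineSelmerDual_embedding_count)
    (hLim : Lim2017.thm35_fineSelmerDual_moduleFinite_of_classicalMuVanishes_of_le_divisionField)
    (hFW : Literature.NumberTheory.IwasawaTheory.ferreroWashington1979_classicalMuVanishes)
    (hCassels : bsdRHS_eq_of_isIsogenous) (hGZK : rank_eq_analyticRank_of_analyticRank_le_one)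
    (hmodL : hasEntireLFunction_rat) :
    Summit.BirchSwinnertonDyer.BirchSwinnertonDyer.Theses.KatoDescentPotSupersingular.WildUpperReducibleDefect := by
  intro W _ _ _ hr hO6 hred _
  exact FineInputsPotSupersingular.missingUpperBoundAt_of_fineInputs_of_classO6 hmod hF hH hLim hFW hCassels hGZK hmodL
    W hO6 hred hr

/-- **The same over the route's live U₀-red aliases** `PublishedInputModularityU0Red` (19382) and `PublishedInputsCasselsGZKEntireU0Red`
(the Cassels / GZK / entire-`L` bundle), plus the four named facts Fine, H2X⁺, Lim 3.5, FW. Conditional; closes nothing.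
[cite: Kato2004Asterisque, proof of Prop. 14.16 (pp. 244–245)] [cite: Serre1967GroupesPDivisibles, §5 Prop. 8] -/
theorem wildUpperReducibleDefect_of_fineInputs_of_aliases (hmod : PublishedInputModularityU0Red)
    (hCGE : PublishedInputsCasselsGZKEntireU0Red)
    (hF : exists_memberHullZetaFineInputs) (hH : exists_iwasawaH2Data_fineSelmerDual_embedding_count)
    (hLim : Lim2017.thm35_fineSelmerDual_moduleFinite_of_classicalMuVanishes_of_le_divisionField)
    (hFW : Literature.NumberTheory.IwasawaTheory.ferreroWashington1979_classicalMuVanishes) :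
    Summit.BirchSwinnertonDyer.BirchSwinnertonDyer.Theses.KatoDescentPotSupersingular.WildUpperReducibleDefect :=
  wildUpperReducibleDefect_of_fineInputs hmod hF hH hLim hFW hCGE.1 hCGE.2.1 hCGE.2.2

/-- **THE ROW TEXT OF `WildRankZeroAssembly` (item 19199) WITH CRUX M REPLACED by {modularity, Fine, H2X⁺, Lim 3.5, FW}**: on the covered
wild rank-`0` rows, L₀ + Kato's upper half (branch A, verbatim as in `wildRankZeroAssembly_proof`: `ClassO6.missingPPartAt_iff_lower_of_kato`)
resp. L₀ + the per-row U₀-red theorem (branch B; only `¬ Irr` of the branch is used) give `MissingPPartAt W 3` — NO Imai, NO 27962.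
Conditional on the displayed inputs; closes nothing. [cite: Kato2004Asterisque, Thm. 14.5 (3) (p. 236), Prop. 14.16 (2) (pp. 244–245)]
[cite: Serre1967GroupesPDivisibles, §5 Prop. 8] [cite: Miller2011LMS, §1 and Def. 1.1] -/
theorem missingPPartAt_of_lower_of_fineInputs_of_classO6 (hL : WildLowerHalfRankZero) (hnf : exists_isNewformOf)
    (hF : exists_memberHullZetaFineInputs) (hH : exists_iwasawaH2Data_fineSelmerDual_embedding_count)
    (hLim : Lim2017.thm35_fineSelmerDual_moduleFinite_of_classicalMuVanishes_of_le_divisionField)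
    (hFW : Literature.NumberTheory.IwasawaTheory.ferreroWashington1979_classicalMuVanishes) (hP : PublishedInputsO6)
    (W : WeierstrassCurve ℚ) [W.IsElliptic] [W.IsGloballyMinimal] [Fact (3 : ℕ).Prime] (hr : W.analyticRank = 0)
    (hO : ClassO6 W 3)
    (hcov : ((∀ n : ℕ, W.HasSurjectiveModNGaloisRep (3 ^ n : ℕ)) ∧ ¬ 3 ∣ W.tamagawaProduct ∧
        ∃ (N : ℕ) (_ : NeZero N) (D : ModularParametrizationData W N), ¬ (3 : ℤ) ∣ D.maninConstant) ∨
      (¬ W.HasIrreducibleModPGaloisRep 3 ∧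
        (∀ (W' : WeierstrassCurve ℚ) [W'.IsElliptic], IsIsogenous W W' → ¬ 3 ^ 2 ∣ W'.torsionOrder) ∧
        ∀ q : ℚ, shaAn W = (q : ℂ) → Even (padicValRat 3 q))) :
    MissingPPartAt W 3 := by
  obtain ⟨hKato, hGZK, hmod, hCassels, hCT⟩ := hP
  have hlow : MissingLowerBoundAt W 3 := hL W hr hO
  rcases hcov with ⟨hsurj, htam, N, hN, D, hc⟩ | ⟨hred, -, -⟩
  · -- branch A: covered by Kato 14.5 (3) under (12.5.2) — the missing input IS the lower half
    haveI := hN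
    have hirr : W.HasIrreducibleModPGaloisRep 3 := by
      have h1 := hsurj 1
      simp only [pow_one] at h1
      exact hasIrreducibleModPGaloisRep_of_hasSurjectiveModNGaloisRep W 3 (by exact_mod_cast h1)
    have hX : ClassX4 W 3 := ⟨hO.1, hO.2.1, hirr⟩
    exact (ClassO6.missingPPartAt_iff_lower_of_kato W 3 hKato hGZK hmod hr hO hX hsurj htam D hc).mpr hlow
  · -- branch B: reducible rows — the per-row U₀-red theorem (sharp count; NO Imai, NO 27962)
    exact missingPPartAt_of_lower_of_upper W 3 hlow
      (FineInputsPotSupersingular.missingUpperBoundAt_of_fineInputs_of_classO6 hnf hF hH hLim hFW hCassels hGZK hmod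
        W hO hred hr)

end Summit.BirchSwinnertonDyer.BirchSwinnertonDyer.Theorems.FineInputsPotSSK9

end
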